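import Summits.AtomisticToContinuum.Crystallization.Theorems.HolmgrenBoyleLindGroundStatesChargeFLCEquilibriumForceBalance
import Summits.AtomisticToContinuum.Crystallization.Theorems.HolmgrenBoyleLindGroundStatesChargeFLCEquilibriumStub1OfPeriodicSupport
import Literature.MathematicalPhysics.StatisticalMechanics.PeriodicConfigurationDelone

/-!
# Crux `HolmgrenBoyleLind.GroundStatesChargeFLCEquilibrium` (stmt-AtomisticToContinuum-6076)
# from the shared hinge `GroundStatesChargePeriodic` (stmt-AtomisticToContinuum-2911)

`groundStatesChargeFLCEquilibrium_of_groundStatesChargePeriodic : GroundStatesChargePeriodic →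
GroundStatesChargeFLCEquilibrium` (CONDITIONAL on the open item 2911). If every sequence of
Lennard-Jones ground states charges ONE periodic configuration `Q` with positive density at every
scale (base points `q ∈ Q.points` inside the counted predicate), then it charges the patches of ONE
FLC Delone set in exact force balance, namely `Λ := Q.points`:

* `Λ` is `δ`-separated, `r`-dense and of finite local complexity
  (`PeriodicConfiguration.exists_delone_flc`, Literature);
* the charging clause of the crux is the hinge's clause verbatim;
* force balance: one matched ground-state particle per scale, re-based to a motif point
  (`exists_motif_matched_of_charged`: `Λ − (y + g) = Λ − y`), one motif point `y₀` good at
  infinitely many of the cofinal scales `(n + 1, 1/(n + 1))` (pigeonhole,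
  `exists_basePoint_matched_of_charged`), and the landed finite-`N` criticality theorem
  `forceBalanceOfChargedPatches` at `q₀ := y₀`.

Consequences recorded for the planners: `PalmRigidity` (9224) ⇒ 2911 (`palmToHinge_proof` with the
proved 9230, 0626) ⇒ this crux; and `PeriodicSupport` (12747) ⇒ stub 1 of the line directly
(`…Stub1OfPeriodicSupport`). All `[folklore]` glue; nothing here closes an item.
-/

noncomputable section

open MeasureTheory Filter
open scoped ENNReal Topology

namespace Summit.AtomisticToContinuum.Crystallization.Theorems.HolmgrenBoyleLindGroundStatesChargeFLCEquilibrium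

open Literature.MathematicalPhysics.StatisticalMechanics

/-! ### One base point matched at every scale (pigeonhole over the motif along `(n + 1, 1/(n + 1))`) -/

/-- **One matched ground-state particle per scale, re-based to the motif.** If a periodic
configuration `Q` is charged by the ground states `x` with positive density at every scale (the
conclusion of `GroundStatesChargePeriodic` for `x` and `Q`), then for all `R, ε > 0` some motif
point `y` is the base point of a two-way `(R, ε)`-matching of the `R`-neighbourhood of one
particle of one `x N` with `x_i + A(Q.points − y)`. [folklore] -/
theorem exists_motif_matched_of_charged (x : (N : ℕ) → (Fin N → EuclideanSpace ℝ (Fin 3)))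
    (Q : PeriodicConfiguration 3)
    (hQ : ∀ R ε : ℝ, 0 < R → 0 < ε → ∃ ρ : ℝ, 0 < ρ ∧ ∃ᶠ N : ℕ in Filter.atTop,
      ρ * (N : ℝ) ≤ (Nat.card {i : Fin N //
        ∃ A : EuclideanSpace ℝ (Fin 3) →ₗᵢ[ℝ] EuclideanSpace ℝ (Fin 3), ∃ q ∈ Q.points,
          (∀ s ∈ Q.points, dist s q ≤ R → ∃ j : Fin N, dist (x N j) (x N i + A (s - q)) ≤ ε) ∧
          (∀ j : Fin N, dist (x N j) (x N i) ≤ R →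
            ∃ s ∈ Q.points, dist (x N j) (x N i + A (s - q)) ≤ ε)} : ℝ)) :
    ∀ R ε : ℝ, 0 < R → 0 < ε → ∃ y ∈ Q.motif, ∃ (N : ℕ) (i : Fin N)
      (A : EuclideanSpace ℝ (Fin 3) →ₗᵢ[ℝ] EuclideanSpace ℝ (Fin 3)),
      (∀ s ∈ Q.points, dist s y ≤ R → ∃ j : Fin N, dist (x N j) (x N i + A (s - y)) ≤ ε) ∧
      (∀ j : Fin N, dist (x N j) (x N i) ≤ R →
        ∃ s ∈ Q.points, dist (x N j) (x N i + A (s - y)) ≤ ε) := by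
  intro R ε hR hε
  obtain ⟨ρ, hρ, hfr⟩ := hQ R ε hR hε
  obtain ⟨N, hN, hN0⟩ := (hfr.and_eventually (Filter.eventually_gt_atTop 0)).exists
  have hρN : (0 : ℝ) < ρ * (N : ℝ) := mul_pos hρ (Nat.cast_pos.2 hN0)
  have hcard := lt_of_lt_of_le hρN hN
  rw [Nat.cast_pos] at hcard
  obtain ⟨⟨⟨i, A, q, hq, hA₁, hA₂⟩⟩, -⟩ := Nat.card_pos_iff.1 hcard
  obtain ⟨y, hy, g, hg, rfl⟩ := hq
  refine ⟨y, hy, N, i, A, ?_, fun j hj => ?_⟩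
  · exact (Q.forall_points_rebase hg (fun d v => d ≤ R →
      ∃ j : Fin N, dist (x N j) (x N i + A v) ≤ ε)).1 hA₁
  · exact (Q.exists_points_rebase hg (fun v => dist (x N j) (x N i + A v) ≤ ε)).1 (hA₂ j hj)

/-- **One base point matched at every scale.** Under the same charging hypothesis, ONE motif point
`y₀` is the base point of a two-way `(R, ε)`-matching by a neighbourhood of a particle of some
`x N`, for ALL `R, ε > 0` (pigeonhole over the motif along the cofinal scales `(n + 1, 1/(n + 1))`,
then monotonicity in the scale). [folklore] -/
theorem exists_basePoint_matched_of_charged (x : (N : ℕ) → (Fin N → EuclideanSpace ℝ (Fin 3)))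
    (Q : PeriodicConfiguration 3)
    (hQ : ∀ R ε : ℝ, 0 < R → 0 < ε → ∃ ρ : ℝ, 0 < ρ ∧ ∃ᶠ N : ℕ in Filter.atTop,
      ρ * (N : ℝ) ≤ (Nat.card {i : Fin N //
        ∃ A : EuclideanSpace ℝ (Fin 3) →ₗᵢ[ℝ] EuclideanSpace ℝ (Fin 3), ∃ q ∈ Q.points,
          (∀ s ∈ Q.points, dist s q ≤ R → ∃ j : Fin N, dist (x N j) (x N i + A (s - q)) ≤ ε) ∧
          (∀ j : Fin N, dist (x N j) (x N i) ≤ R →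
            ∃ s ∈ Q.points, dist (x N j) (x N i + A (s - q)) ≤ ε)} : ℝ)) :
    ∃ y₀ ∈ Q.motif, ∀ R ε : ℝ, 0 < R → 0 < ε → ∃ (N : ℕ) (i : Fin N)
      (A : EuclideanSpace ℝ (Fin 3) →ₗᵢ[ℝ] EuclideanSpace ℝ (Fin 3)),
      (∀ s ∈ Q.points, dist s y₀ ≤ R → ∃ j : Fin N, dist (x N j) (x N i + A (s - y₀)) ≤ ε) ∧
      (∀ j : Fin N, dist (x N j) (x N i) ≤ R →
        ∃ s ∈ Q.points, dist (x N j) (x N i + A (s - y₀)) ≤ ε) := by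
  have hstep := exists_motif_matched_of_charged x Q hQ
  obtain ⟨y₀, hy₀, hfr⟩ := exists_frequently_of_forall_exists Q.motif
    (p := fun y n => ∃ (N : ℕ) (i : Fin N)
      (A : EuclideanSpace ℝ (Fin 3) →ₗᵢ[ℝ] EuclideanSpace ℝ (Fin 3)),
      (∀ s ∈ Q.points, dist s y ≤ (n : ℝ) + 1 →
        ∃ j : Fin N, dist (x N j) (x N i + A (s - y)) ≤ 1 / ((n : ℝ) + 1)) ∧
      (∀ j : Fin N, dist (x N j) (x N i) ≤ (n : ℝ) + 1 →
        ∃ s ∈ Q.points, dist (x N j) (x N i + A (s - y)) ≤ 1 / ((n : ℝ) + 1)))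
    fun n => hstep ((n : ℝ) + 1) (1 / ((n : ℝ) + 1)) (by positivity) (by positivity)
  refine ⟨y₀, hy₀, fun R ε hR hε => ?_⟩
  obtain ⟨n₀, hn₀⟩ := exists_nat_ge (max R (1 / ε))
  obtain ⟨m, hm, N, i, A, h1, h2⟩ := Filter.frequently_atTop.1 hfr n₀
  obtain ⟨hRm, hεm⟩ := scale_le_of_le hε hn₀ hm
  exact ⟨N, i, A, fun s hs hsR => (h1 s hs (hsR.trans hRm)).imp fun j hj => hj.trans hεm,
    fun j hj => (h2 j (hj.trans hRm)).imp fun s hs => ⟨hs.1, hs.2.trans hεm⟩⟩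

/-- **The crux from the shared hinge `GroundStatesChargePeriodic` (item 2911)** — a
CONDITIONAL result (its hypothesis is the open support item 2911 of this route, shared with
`BenjaminiSchrammGroundStates` / `PalmUnimodularRigidity`, where it is derived from `PalmRigidity`).
Given a ground-state sequence `x`, the hinge gives ONE periodic configuration `Q` charged at every
scale — verbatim the charging clause of the crux with `Λ := Q.points`; `Λ` is an FLC Delone set
(`PeriodicConfiguration.exists_delone_flc`); ONE motif point `y₀` is matched at every scale by a
neighbourhood of a ground-state particle (`exists_basePoint_matched_of_charged`), which is the
hypothesis of `forceBalanceOfChargedPatches` (finite-`N` criticality ⇒ force balance, landed) at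
the base point `y₀`, whence exact Lennard-Jones force balance of `Λ` at every point. Together with
the route's assembly (`closes`: LIM + UC + HSR ⇒ 2911) this makes the crux EQUIVALENT to the hinge
granted `HalfSpaceUniqueContinuation` and `HalfSpaceRigidityPeriodic`. [folklore] -/
theorem groundStatesChargeFLCEquilibrium_of_groundStatesChargePeriodic :
    Summit.AtomisticToContinuum.Crystallization.Theses.HolmgrenBoyleLind.GroundStatesChargePeriodic →
    Summit.AtomisticToContinuum.Crystallization.Theses.HolmgrenBoyleLind.GroundStatesChargeFLCEquilibrium := by
  intro hGCP x hx
  -- ONE periodic configuration charged at every scale (item 2911)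
  obtain ⟨Q, hQ⟩ := hGCP x hx
  -- its point set is an FLC Delone set
  obtain ⟨δ, r, hδ, hr, hsep, hden, hflc⟩ := Q.exists_delone_flc
  -- one base point matched at every scale by a ground-state particle
  obtain ⟨y₀, hy₀, hmatch⟩ := exists_basePoint_matched_of_charged x Q hQ
  refine ⟨Q.points, δ, r, hδ, hr, hsep, hden, hflc, ?_, hQ⟩
  -- force balance at every point: finite-`N` criticality at the base point `y₀`
  refine forceBalanceOfChargedPatches Q.points δ hδ hsep y₀ (Q.mem_points_of_mem_motif hy₀)
    fun R ε hR hε => ?_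
  obtain ⟨N, i, A, h1, h2⟩ := hmatch R ε hR hε
  exact ⟨N, x N, i, A, hx N, h1, h2⟩

end Summit.AtomisticToContinuum.Crystallization.Theorems.HolmgrenBoyleLindGroundStatesChargeFLCEquilibrium

end
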